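import Summits.BirchSwinnertonDyer.BirchSwinnertonDyer.Theorems.KolyvaginDepthDoorKNSupplyExactReadingDepthRowLB
import Summits.BirchSwinnertonDyer.BirchSwinnertonDyer.Theorems.KolyvaginDepthDoorDepthTableLambdaRowPredictionSpade
import Summits.BirchSwinnertonDyer.BirchSwinnertonDyer.Theorems.KolyvaginDepthDoorDepthTableRowsOfPrint2
import Summits.BirchSwinnertonDyer.BirchSwinnertonDyer.Theorems.KolyvaginDepthDoorDepthTableRowsOfPrint3
import Summits.BirchSwinnertonDyer.BirchSwinnertonDyer.Theorems.KolyvaginDepthDoorDepthTableRowKit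
import Summits.BirchSwinnertonDyer.BirchSwinnertonDyer.Theorems.KolyvaginDepthDoorDepthTableRowKitPrint
import Summits.BirchSwinnertonDyer.BirchSwinnertonDyer.Theorems.Rank2ObservatoryKernelCerts001
import Literature.NumberTheory.DiophantineGeometry.PastenValuationProductsProofs
import HarnessLib

/-!
# Route `KolyvaginDepthDoor`, crux `KolyvaginDepthSupplyKN` (stmt-BirchSwinnertonDyer-22820) —
# DEPTH-TABLE ROWS READ EXACTLY ON W. ZHANG'S ♠ CELL (1/2: `433a1` `(5, −8)`, `446d1` `(5, −23)`, `563a1` `(5, −8)`, `571b1` `(5, −8)`, `643a1` `(5, −8)`) — two-sided, NO twist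
# pinning, `p` INERT in the Heegner field, from TWO KNOWN POINTS (no 2-descent)

Helper file of the lead prover of line `levelone` (kdd-p1 g14; `--supports stmt-BirchSwinnertonDyer-22820
--as helper`); it closes nothing and BSD is not proved by it.

The row reading on the ♠ cell, `kolyvaginClass_prime_ne_zero_iff_rankTwo_shaTrivial_twistSelmer_of_lemma84`
(file `KolyvaginDepthDoorKNSupplyExactReadingDepthRowLB`), says per `(E, p, K)` — `E` on W. Zhang's ♠ cell
with two independent rational points, `p ≥ 5` good ordinary with the tower onto and ♠ (1), `K` Heegner with
`p ∤ d_K` (INERT OR SPLIT) —: «∃ frame, Kolyvagin prime `ℓ`, datum: `c_1(ℓ) ≠ 0`» `↔` «`rank E(ℚ) = 2` ∧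
`Ш(E/ℚ)[p] = 0` ∧ `#Sel_p(E^{(d_K)}/ℚ) ≤ p`», modulo (γ) = Gross 1991 Prop. 3.7 (2) and W. Zhang 2014
Lemma 8.4 (1) / Thm. 9.1 BY NAME. This file instantiates it at square-free-conductor rank-2 rows of the
depth table whose `p` is INERT in `K` (the split rows are in `KolyvaginDepthDoorDepthTableRowsExactReading`),
discharging every per-curve side condition in the kernel: two independent points
(`Rank2ObservatoryKernelCerts*.C<label>.two_le_rank`), non-CM, `ρ_{E,p^n}` onto (g9/g10), `p` good ordinary,
♠ (1) and semistability (`C<label>.spade_p`, g10; ♠ (2) vacuous by `isSemistable_iff_squarefree_conductorNorm`),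
the Kodaira–Néron table, and the Heegner hypothesis from Kronecker symbols.

RESULT, per row, for ANY imaginary quadratic `K` with the listed `d_K`: the depth table's bit is EXACTLY
«`rank E(ℚ) = 2` ∧ `Ш(E)[p] = 0` ∧ `#Sel_p(E^{(d_K)}) ≤ p`» — modulo (γ) and Zhang's fact. No `hF`, no
twist point, no twist pinning, no `Ш`-hypothesis, no 2-descent. CONDITIONAL on those two named facts;
per curve; BSD is NOT proved by any of this.

References: [WZhang2014] Lemma 8.4 (1) (p. 236), Thm. 9.1 (p. 240), Hypothesis ♠ (p. 195);
[GrossLMS1991] Prop. 3.7 (2); [JetchevLauterStein2009] §3.6 (arXiv:0707.0032); [CremonaAlgorithms1997]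
Table 1.
-/

set_option linter.dupNamespace false

noncomputable section

open scoped Classical NumberField

namespace Summit.BirchSwinnertonDyer.BirchSwinnertonDyer.Theorems.KolyvaginDepthDoor

open Literature.NumberTheory.EllipticCurves Literature.NumberTheory.EllipticCurves.ModularForms
  WeierstrassCurve NumberField IsDedekindDomain
open Summit.BirchSwinnertonDyer.BirchSwinnertonDyer.Theorems
open Summit.BirchSwinnertonDyer.BirchSwinnertonDyer.Rank2Observatory

/-! ## `433a1 = [1, 0, 0, 0, 1]` at `(p, d_K) = (5, -8)` (N = 433 prime; `Δ = -433`; `5` inert) -/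

namespace C433a1

/-- **DEPTH-TABLE ROW `433a1`, `(p, d_K) = (5, −8)`, READ EXACTLY on the ♠ cell (two-sided; no `hF`,
no twist point, no twist pinning, no 2-descent; `5` inert in `K`).** For `E = 433a1` (two independent
points by `KernelCerts001.C433a1.two_le_rank`) and ANY imaginary quadratic `K` with `d_K = −8`: «some frame,
some Kolyvagin prime `ℓ`, some datum of conductor `ℓ` with `c_1(ℓ) ≠ 0`» `↔` «`rank E(ℚ) = 2` ∧
`Ш(E/ℚ)[5] = 0` ∧ `#Sel_5(E^{(−8)}/ℚ) ≤ 5`». Side conditions all kernel theorems (`5` good ordinary,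
`ρ_{E,5^n}` onto, non-CM, ♠ (1) + semistable from `Δ = -433`, Heegner for `N_E`). CONDITIONAL on (γ)
and W. Zhang's Lemma 8.4 (1) / Thm. 9.1 by name; per curve; BSD is not proved by it.
[cite: WZhang2014, Lemma 8.4 (1) (p. 236), Thm. 9.1 (p. 240)] [cite: GrossLMS1991, Prop. 3.7 (2)]
[cite: JetchevLauterStein2009, §3.6 (arXiv:0707.0032)] [cite: CremonaAlgorithms1997, Table 1 (433a1)] -/
theorem exactRowZhang_5_neg8
    (h372 : GrossLMS1991.prop37_2_frobeniusCongruence)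
    (h84 : Literature.NumberTheory.EllipticCurves.WZhang2014_lemma84_exists_minimal_kolyvaginClass_one_selmerCard)
    (K : Type) [Field K] [NumberField K] (hK : IsImaginaryQuadratic K)
    (hD : NumberField.discr K = -8) :
    haveI := isElliptic_c433a1;
    haveI := isGloballyMinimal_c433a1;
    haveI : NeZero (((⟨1, 0, 0, 0, 1⟩ : WeierstrassCurve ℤ).map (Int.castRingHom ℚ)).conductorNorm ℤ) := neZero_conductorNorm_of_isElliptic _;
    haveI := Fact.mk (by norm_num : Nat.Prime 5);
    (∃ (Dt : ModularParametrizationData ((⟨1, 0, 0, 0, 1⟩ : WeierstrassCurve ℤ).map (Int.castRingHom ℚ)) (((⟨1, 0, 0, 0, 1⟩ : WeierstrassCurve ℤ).map (Int.castRingHom ℚ)).conductorNorm ℤ)) (β : ℤ)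
      (ι : K →+* ℂ) (ℓ : ℕ) (d : KolyvaginHeegnerData Dt β ι ℓ),
      ℓ.Prime ∧ Zhang2014.IsKolyvaginPrime (((⟨1, 0, 0, 0, 1⟩ : WeierstrassCurve ℤ).map (Int.castRingHom ℚ)).conductorNorm ℤ) ((⟨1, 0, 0, 0, 1⟩ : WeierstrassCurve ℤ).map (Int.castRingHom ℚ)) K 5 ℓ ∧
        d.kolyvaginClass (p := 5) (by norm_num) 1 ≠ 0) ↔
    (((⟨1, 0, 0, 0, 1⟩ : WeierstrassCurve ℤ).map (Int.castRingHom ℚ)).mordellWeilRank = 2 ∧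
      (((⟨1, 0, 0, 0, 1⟩ : WeierstrassCurve ℤ).map (Int.castRingHom ℚ)).sha ⊓ AddSubgroup.torsionBy ((⟨1, 0, 0, 0, 1⟩ : WeierstrassCurve ℤ).map (Int.castRingHom ℚ)).galH1 ((5 : ℕ) : ℤ) : AddSubgroup _) = ⊥ ∧
      Nat.card ((((⟨1, 0, 0, 0, 1⟩ : WeierstrassCurve ℤ).map (Int.castRingHom ℚ)).quadraticTwist (NumberField.discr K : ℚ)).selmerGroup (5 : ℕ)) ≤ 5) := by
  haveI := isElliptic_c433a1
  haveI := isGloballyMinimal_c433a1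
  haveI : NeZero (((⟨1, 0, 0, 0, 1⟩ : WeierstrassCurve ℤ).map (Int.castRingHom ℚ)).conductorNorm ℤ) := neZero_conductorNorm_of_isElliptic _
  haveI := Fact.mk (by norm_num : Nat.Prime 5)
  have hgo := goodOrdinary_5
  have hsp := spade_5
  have hH := satisfiesHeegnerHypothesis_conductorNorm_of_intModel intModel K hK.1 hD heegner_neg8
  have hKN := not_dvd_ordMinimalDiscriminant_of_intModel_table intModel (p := 5) (Δ₀ := -433)
    (by decide +kernel) (B := 11) (by decide +kernel) (by decide +kernel)
  have hS2 : ¬ Squarefree (((⟨1, 0, 0, 0, 1⟩ : WeierstrassCurve ℤ).map (Int.castRingHom ℚ)).conductorNorm ℤ) →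
      (∃ (ℓ : ℕ) (_ : Fact ℓ.Prime), ((⟨1, 0, 0, 0, 1⟩ : WeierstrassCurve ℤ).map (Int.castRingHom ℚ)).HasMultiplicativeReductionAtPrime ℓ ∧
          ¬ 5 ∣ padicValInt ℓ ((⟨1, 0, 0, 0, 1⟩ : WeierstrassCurve ℤ).map (Int.castRingHom ℚ)).minimalDiscriminantInt) ∧
        ∃ (ℓ₁ ℓ₂ : ℕ) (_ : Fact ℓ₁.Prime) (_ : Fact ℓ₂.Prime), ℓ₁ ≠ ℓ₂ ∧
          ((⟨1, 0, 0, 0, 1⟩ : WeierstrassCurve ℤ).map (Int.castRingHom ℚ)).HasMultiplicativeReductionAtPrime ℓ₁ ∧ ((⟨1, 0, 0, 0, 1⟩ : WeierstrassCurve ℤ).map (Int.castRingHom ℚ)).HasMultiplicativeReductionAtPrime ℓ₂ :=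
    fun hns ↦ absurd (((⟨1, 0, 0, 0, 1⟩ : WeierstrassCurve ℤ).map (Int.castRingHom ℚ)).isSemistable_iff_squarefree_conductorNorm.mp hsp.2) hns
  have hD3 : NumberField.discr K ≠ -3 := by rw [hD]; norm_num
  have hD4 : NumberField.discr K ≠ -4 := by rw [hD]; norm_num
  have hpD : ¬ (((5 : ℕ) : ℤ) ∣ NumberField.discr K) := by rw [hD]; norm_num
  exact kolyvaginClass_prime_ne_zero_iff_rankTwo_shaTrivial_twistSelmer_of_lemma84 h372 h84 _ not_hasCM
    KernelCerts001.C433a1.two_le_rank 5 (by norm_num) hgo.1 hgo.2 hasSurjectiveModNGaloisRep_pow_5 hKN hsp.1 hS2 K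
    hK hD3 hD4 hpD hH

end C433a1

/-! ## `446d1 = [1, -1, 0, -4, 4]` at `(p, d_K) = (5, -23)` (N = 2·223; `Δ = 892`; `5` inert) -/

namespace C446d1

/-- **DEPTH-TABLE ROW `446d1`, `(p, d_K) = (5, −23)`, READ EXACTLY on the ♠ cell (two-sided; no `hF`,
no twist point, no twist pinning, no 2-descent; `5` inert in `K`).** For `E = 446d1` (two independent
points by `KernelCerts001.C446d1.two_le_rank`) and ANY imaginary quadratic `K` with `d_K = −23`: «some frame,
some Kolyvagin prime `ℓ`, some datum of conductor `ℓ` with `c_1(ℓ) ≠ 0`» `↔` «`rank E(ℚ) = 2` ∧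
`Ш(E/ℚ)[5] = 0` ∧ `#Sel_5(E^{(−23)}/ℚ) ≤ 5`». Side conditions all kernel theorems (`5` good ordinary,
`ρ_{E,5^n}` onto, non-CM, ♠ (1) + semistable from `Δ = 892`, Heegner for `N_E`). CONDITIONAL on (γ)
and W. Zhang's Lemma 8.4 (1) / Thm. 9.1 by name; per curve; BSD is not proved by it.
[cite: WZhang2014, Lemma 8.4 (1) (p. 236), Thm. 9.1 (p. 240)] [cite: GrossLMS1991, Prop. 3.7 (2)]
[cite: JetchevLauterStein2009, §3.6 (arXiv:0707.0032)] [cite: CremonaAlgorithms1997, Table 1 (446d1)] -/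
theorem exactRowZhang_5_neg23
    (h372 : GrossLMS1991.prop37_2_frobeniusCongruence)
    (h84 : Literature.NumberTheory.EllipticCurves.WZhang2014_lemma84_exists_minimal_kolyvaginClass_one_selmerCard)
    (K : Type) [Field K] [NumberField K] (hK : IsImaginaryQuadratic K)
    (hD : NumberField.discr K = -23) :
    haveI := isElliptic_c446d1;
    haveI := isGloballyMinimal_c446d1;
    haveI : NeZero (((⟨1, -1, 0, -4, 4⟩ : WeierstrassCurve ℤ).map (Int.castRingHom ℚ)).conductorNorm ℤ) := neZero_conductorNorm_of_isElliptic _;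
    haveI := Fact.mk (by norm_num : Nat.Prime 5);
    (∃ (Dt : ModularParametrizationData ((⟨1, -1, 0, -4, 4⟩ : WeierstrassCurve ℤ).map (Int.castRingHom ℚ)) (((⟨1, -1, 0, -4, 4⟩ : WeierstrassCurve ℤ).map (Int.castRingHom ℚ)).conductorNorm ℤ)) (β : ℤ)
      (ι : K →+* ℂ) (ℓ : ℕ) (d : KolyvaginHeegnerData Dt β ι ℓ),
      ℓ.Prime ∧ Zhang2014.IsKolyvaginPrime (((⟨1, -1, 0, -4, 4⟩ : WeierstrassCurve ℤ).map (Int.castRingHom ℚ)).conductorNorm ℤ) ((⟨1, -1, 0, -4, 4⟩ : WeierstrassCurve ℤ).map (Int.castRingHom ℚ)) K 5 ℓ ∧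
        d.kolyvaginClass (p := 5) (by norm_num) 1 ≠ 0) ↔
    (((⟨1, -1, 0, -4, 4⟩ : WeierstrassCurve ℤ).map (Int.castRingHom ℚ)).mordellWeilRank = 2 ∧
      (((⟨1, -1, 0, -4, 4⟩ : WeierstrassCurve ℤ).map (Int.castRingHom ℚ)).sha ⊓ AddSubgroup.torsionBy ((⟨1, -1, 0, -4, 4⟩ : WeierstrassCurve ℤ).map (Int.castRingHom ℚ)).galH1 ((5 : ℕ) : ℤ) : AddSubgroup _) = ⊥ ∧
      Nat.card ((((⟨1, -1, 0, -4, 4⟩ : WeierstrassCurve ℤ).map (Int.castRingHom ℚ)).quadraticTwist (NumberField.discr K : ℚ)).selmerGroup (5 : ℕ)) ≤ 5) := by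
  haveI := isElliptic_c446d1
  haveI := isGloballyMinimal_c446d1
  haveI : NeZero (((⟨1, -1, 0, -4, 4⟩ : WeierstrassCurve ℤ).map (Int.castRingHom ℚ)).conductorNorm ℤ) := neZero_conductorNorm_of_isElliptic _
  haveI := Fact.mk (by norm_num : Nat.Prime 5)
  have hgo := goodOrdinary_5
  have hsp := spade_5
  have hH := satisfiesHeegnerHypothesis_conductorNorm_of_intModel intModel K hK.1 hD heegner_neg23
  have hKN := not_dvd_ordMinimalDiscriminant_of_intModel_table intModel (p := 5) (Δ₀ := 892)
    (by decide +kernel) (B := 11) (by decide +kernel) (by decide +kernel)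
  have hS2 : ¬ Squarefree (((⟨1, -1, 0, -4, 4⟩ : WeierstrassCurve ℤ).map (Int.castRingHom ℚ)).conductorNorm ℤ) →
      (∃ (ℓ : ℕ) (_ : Fact ℓ.Prime), ((⟨1, -1, 0, -4, 4⟩ : WeierstrassCurve ℤ).map (Int.castRingHom ℚ)).HasMultiplicativeReductionAtPrime ℓ ∧
          ¬ 5 ∣ padicValInt ℓ ((⟨1, -1, 0, -4, 4⟩ : WeierstrassCurve ℤ).map (Int.castRingHom ℚ)).minimalDiscriminantInt) ∧
        ∃ (ℓ₁ ℓ₂ : ℕ) (_ : Fact ℓ₁.Prime) (_ : Fact ℓ₂.Prime), ℓ₁ ≠ ℓ₂ ∧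
          ((⟨1, -1, 0, -4, 4⟩ : WeierstrassCurve ℤ).map (Int.castRingHom ℚ)).HasMultiplicativeReductionAtPrime ℓ₁ ∧ ((⟨1, -1, 0, -4, 4⟩ : WeierstrassCurve ℤ).map (Int.castRingHom ℚ)).HasMultiplicativeReductionAtPrime ℓ₂ :=
    fun hns ↦ absurd (((⟨1, -1, 0, -4, 4⟩ : WeierstrassCurve ℤ).map (Int.castRingHom ℚ)).isSemistable_iff_squarefree_conductorNorm.mp hsp.2) hns
  have hD3 : NumberField.discr K ≠ -3 := by rw [hD]; norm_num
  have hD4 : NumberField.discr K ≠ -4 := by rw [hD]; norm_num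
  have hpD : ¬ (((5 : ℕ) : ℤ) ∣ NumberField.discr K) := by rw [hD]; norm_num
  exact kolyvaginClass_prime_ne_zero_iff_rankTwo_shaTrivial_twistSelmer_of_lemma84 h372 h84 _ not_hasCM
    KernelCerts001.C446d1.two_le_rank 5 (by norm_num) hgo.1 hgo.2 hasSurjectiveModNGaloisRep_pow_5 hKN hsp.1 hS2 K
    hK hD3 hD4 hpD hH

end C446d1

/-! ## `563a1 = [1, 1, 1, -15, 16]` at `(p, d_K) = (5, -8)` (N = 563 prime; `Δ = -563`; `5` inert) -/

namespace C563a1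

/-- **DEPTH-TABLE ROW `563a1`, `(p, d_K) = (5, −8)`, READ EXACTLY on the ♠ cell (two-sided; no `hF`,
no twist point, no twist pinning, no 2-descent; `5` inert in `K`).** For `E = 563a1` (two independent
points by `KernelCerts001.C563a1.two_le_rank`) and ANY imaginary quadratic `K` with `d_K = −8`: «some frame,
some Kolyvagin prime `ℓ`, some datum of conductor `ℓ` with `c_1(ℓ) ≠ 0`» `↔` «`rank E(ℚ) = 2` ∧
`Ш(E/ℚ)[5] = 0` ∧ `#Sel_5(E^{(−8)}/ℚ) ≤ 5`». Side conditions all kernel theorems (`5` good ordinary,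
`ρ_{E,5^n}` onto, non-CM, ♠ (1) + semistable from `Δ = -563`, Heegner for `N_E`). CONDITIONAL on (γ)
and W. Zhang's Lemma 8.4 (1) / Thm. 9.1 by name; per curve; BSD is not proved by it.
[cite: WZhang2014, Lemma 8.4 (1) (p. 236), Thm. 9.1 (p. 240)] [cite: GrossLMS1991, Prop. 3.7 (2)]
[cite: JetchevLauterStein2009, §3.6 (arXiv:0707.0032)] [cite: CremonaAlgorithms1997, Table 1 (563a1)] -/
theorem exactRowZhang_5_neg8
    (h372 : GrossLMS1991.prop37_2_frobeniusCongruence)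
    (h84 : Literature.NumberTheory.EllipticCurves.WZhang2014_lemma84_exists_minimal_kolyvaginClass_one_selmerCard)
    (K : Type) [Field K] [NumberField K] (hK : IsImaginaryQuadratic K)
    (hD : NumberField.discr K = -8) :
    haveI := isElliptic_c563a1;
    haveI := isGloballyMinimal_c563a1;
    haveI : NeZero (((⟨1, 1, 1, -15, 16⟩ : WeierstrassCurve ℤ).map (Int.castRingHom ℚ)).conductorNorm ℤ) := neZero_conductorNorm_of_isElliptic _;
    haveI := Fact.mk (by norm_num : Nat.Prime 5);
    (∃ (Dt : ModularParametrizationData ((⟨1, 1, 1, -15, 16⟩ : WeierstrassCurve ℤ).map (Int.castRingHom ℚ)) (((⟨1, 1, 1, -15, 16⟩ : WeierstrassCurve ℤ).map (Int.castRingHom ℚ)).conductorNorm ℤ)) (β : ℤ)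
      (ι : K →+* ℂ) (ℓ : ℕ) (d : KolyvaginHeegnerData Dt β ι ℓ),
      ℓ.Prime ∧ Zhang2014.IsKolyvaginPrime (((⟨1, 1, 1, -15, 16⟩ : WeierstrassCurve ℤ).map (Int.castRingHom ℚ)).conductorNorm ℤ) ((⟨1, 1, 1, -15, 16⟩ : WeierstrassCurve ℤ).map (Int.castRingHom ℚ)) K 5 ℓ ∧
        d.kolyvaginClass (p := 5) (by norm_num) 1 ≠ 0) ↔
    (((⟨1, 1, 1, -15, 16⟩ : WeierstrassCurve ℤ).map (Int.castRingHom ℚ)).mordellWeilRank = 2 ∧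
      (((⟨1, 1, 1, -15, 16⟩ : WeierstrassCurve ℤ).map (Int.castRingHom ℚ)).sha ⊓ AddSubgroup.torsionBy ((⟨1, 1, 1, -15, 16⟩ : WeierstrassCurve ℤ).map (Int.castRingHom ℚ)).galH1 ((5 : ℕ) : ℤ) : AddSubgroup _) = ⊥ ∧
      Nat.card ((((⟨1, 1, 1, -15, 16⟩ : WeierstrassCurve ℤ).map (Int.castRingHom ℚ)).quadraticTwist (NumberField.discr K : ℚ)).selmerGroup (5 : ℕ)) ≤ 5) := by
  haveI := isElliptic_c563a1
  haveI := isGloballyMinimal_c563a1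
  haveI : NeZero (((⟨1, 1, 1, -15, 16⟩ : WeierstrassCurve ℤ).map (Int.castRingHom ℚ)).conductorNorm ℤ) := neZero_conductorNorm_of_isElliptic _
  haveI := Fact.mk (by norm_num : Nat.Prime 5)
  have hgo := goodOrdinary_5
  have hsp := spade_5
  have hH := satisfiesHeegnerHypothesis_conductorNorm_of_intModel intModel K hK.1 hD heegner_neg8
  have hKN := not_dvd_ordMinimalDiscriminant_of_intModel_table intModel (p := 5) (Δ₀ := -563)
    (by decide +kernel) (B := 11) (by decide +kernel) (by decide +kernel)
  have hS2 : ¬ Squarefree (((⟨1, 1, 1, -15, 16⟩ : WeierstrassCurve ℤ).map (Int.castRingHom ℚ)).conductorNorm ℤ) →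
      (∃ (ℓ : ℕ) (_ : Fact ℓ.Prime), ((⟨1, 1, 1, -15, 16⟩ : WeierstrassCurve ℤ).map (Int.castRingHom ℚ)).HasMultiplicativeReductionAtPrime ℓ ∧
          ¬ 5 ∣ padicValInt ℓ ((⟨1, 1, 1, -15, 16⟩ : WeierstrassCurve ℤ).map (Int.castRingHom ℚ)).minimalDiscriminantInt) ∧
        ∃ (ℓ₁ ℓ₂ : ℕ) (_ : Fact ℓ₁.Prime) (_ : Fact ℓ₂.Prime), ℓ₁ ≠ ℓ₂ ∧
          ((⟨1, 1, 1, -15, 16⟩ : WeierstrassCurve ℤ).map (Int.castRingHom ℚ)).HasMultiplicativeReductionAtPrime ℓ₁ ∧ ((⟨1, 1, 1, -15, 16⟩ : WeierstrassCurve ℤ).map (Int.castRingHom ℚ)).HasMultiplicativeReductionAtPrime ℓ₂ :=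
    fun hns ↦ absurd (((⟨1, 1, 1, -15, 16⟩ : WeierstrassCurve ℤ).map (Int.castRingHom ℚ)).isSemistable_iff_squarefree_conductorNorm.mp hsp.2) hns
  have hD3 : NumberField.discr K ≠ -3 := by rw [hD]; norm_num
  have hD4 : NumberField.discr K ≠ -4 := by rw [hD]; norm_num
  have hpD : ¬ (((5 : ℕ) : ℤ) ∣ NumberField.discr K) := by rw [hD]; norm_num
  exact kolyvaginClass_prime_ne_zero_iff_rankTwo_shaTrivial_twistSelmer_of_lemma84 h372 h84 _ not_hasCM
    KernelCerts001.C563a1.two_le_rank 5 (by norm_num) hgo.1 hgo.2 hasSurjectiveModNGaloisRep_pow_5 hKN hsp.1 hS2 K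
    hK hD3 hD4 hpD hH

end C563a1

/-! ## `571b1 = [0, 1, 1, -4, 2]` at `(p, d_K) = (5, -8)` (N = 571 prime; `Δ = -571`; `5` inert) -/

namespace C571b1

/-- **DEPTH-TABLE ROW `571b1`, `(p, d_K) = (5, −8)`, READ EXACTLY on the ♠ cell (two-sided; no `hF`,
no twist point, no twist pinning, no 2-descent; `5` inert in `K`).** For `E = 571b1` (two independent
points by `KernelCerts001.C571b1.two_le_rank`) and ANY imaginary quadratic `K` with `d_K = −8`: «some frame,
some Kolyvagin prime `ℓ`, some datum of conductor `ℓ` with `c_1(ℓ) ≠ 0`» `↔` «`rank E(ℚ) = 2` ∧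
`Ш(E/ℚ)[5] = 0` ∧ `#Sel_5(E^{(−8)}/ℚ) ≤ 5`». Side conditions all kernel theorems (`5` good ordinary,
`ρ_{E,5^n}` onto, non-CM, ♠ (1) + semistable from `Δ = -571`, Heegner for `N_E`). CONDITIONAL on (γ)
and W. Zhang's Lemma 8.4 (1) / Thm. 9.1 by name; per curve; BSD is not proved by it.
[cite: WZhang2014, Lemma 8.4 (1) (p. 236), Thm. 9.1 (p. 240)] [cite: GrossLMS1991, Prop. 3.7 (2)]
[cite: JetchevLauterStein2009, §3.6 (arXiv:0707.0032)] [cite: CremonaAlgorithms1997, Table 1 (571b1)] -/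
theorem exactRowZhang_5_neg8
    (h372 : GrossLMS1991.prop37_2_frobeniusCongruence)
    (h84 : Literature.NumberTheory.EllipticCurves.WZhang2014_lemma84_exists_minimal_kolyvaginClass_one_selmerCard)
    (K : Type) [Field K] [NumberField K] (hK : IsImaginaryQuadratic K)
    (hD : NumberField.discr K = -8) :
    haveI := isElliptic_c571b1;
    haveI := isGloballyMinimal_c571b1;
    haveI : NeZero (((⟨0, 1, 1, -4, 2⟩ : WeierstrassCurve ℤ).map (Int.castRingHom ℚ)).conductorNorm ℤ) := neZero_conductorNorm_of_isElliptic _;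
    haveI := Fact.mk (by norm_num : Nat.Prime 5);
    (∃ (Dt : ModularParametrizationData ((⟨0, 1, 1, -4, 2⟩ : WeierstrassCurve ℤ).map (Int.castRingHom ℚ)) (((⟨0, 1, 1, -4, 2⟩ : WeierstrassCurve ℤ).map (Int.castRingHom ℚ)).conductorNorm ℤ)) (β : ℤ)
      (ι : K →+* ℂ) (ℓ : ℕ) (d : KolyvaginHeegnerData Dt β ι ℓ),
      ℓ.Prime ∧ Zhang2014.IsKolyvaginPrime (((⟨0, 1, 1, -4, 2⟩ : WeierstrassCurve ℤ).map (Int.castRingHom ℚ)).conductorNorm ℤ) ((⟨0, 1, 1, -4, 2⟩ : WeierstrassCurve ℤ).map (Int.castRingHom ℚ)) K 5 ℓ ∧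
        d.kolyvaginClass (p := 5) (by norm_num) 1 ≠ 0) ↔
    (((⟨0, 1, 1, -4, 2⟩ : WeierstrassCurve ℤ).map (Int.castRingHom ℚ)).mordellWeilRank = 2 ∧
      (((⟨0, 1, 1, -4, 2⟩ : WeierstrassCurve ℤ).map (Int.castRingHom ℚ)).sha ⊓ AddSubgroup.torsionBy ((⟨0, 1, 1, -4, 2⟩ : WeierstrassCurve ℤ).map (Int.castRingHom ℚ)).galH1 ((5 : ℕ) : ℤ) : AddSubgroup _) = ⊥ ∧
      Nat.card ((((⟨0, 1, 1, -4, 2⟩ : WeierstrassCurve ℤ).map (Int.castRingHom ℚ)).quadraticTwist (NumberField.discr K : ℚ)).selmerGroup (5 : ℕ)) ≤ 5) := by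
  haveI := isElliptic_c571b1
  haveI := isGloballyMinimal_c571b1
  haveI : NeZero (((⟨0, 1, 1, -4, 2⟩ : WeierstrassCurve ℤ).map (Int.castRingHom ℚ)).conductorNorm ℤ) := neZero_conductorNorm_of_isElliptic _
  haveI := Fact.mk (by norm_num : Nat.Prime 5)
  have hgo := goodOrdinary_5
  have hsp := spade_5
  have hH := satisfiesHeegnerHypothesis_conductorNorm_of_intModel intModel K hK.1 hD heegner_neg8
  have hKN := not_dvd_ordMinimalDiscriminant_of_intModel_table intModel (p := 5) (Δ₀ := -571)
    (by decide +kernel) (B := 11) (by decide +kernel) (by decide +kernel)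
  have hS2 : ¬ Squarefree (((⟨0, 1, 1, -4, 2⟩ : WeierstrassCurve ℤ).map (Int.castRingHom ℚ)).conductorNorm ℤ) →
      (∃ (ℓ : ℕ) (_ : Fact ℓ.Prime), ((⟨0, 1, 1, -4, 2⟩ : WeierstrassCurve ℤ).map (Int.castRingHom ℚ)).HasMultiplicativeReductionAtPrime ℓ ∧
          ¬ 5 ∣ padicValInt ℓ ((⟨0, 1, 1, -4, 2⟩ : WeierstrassCurve ℤ).map (Int.castRingHom ℚ)).minimalDiscriminantInt) ∧
        ∃ (ℓ₁ ℓ₂ : ℕ) (_ : Fact ℓ₁.Prime) (_ : Fact ℓ₂.Prime), ℓ₁ ≠ ℓ₂ ∧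
          ((⟨0, 1, 1, -4, 2⟩ : WeierstrassCurve ℤ).map (Int.castRingHom ℚ)).HasMultiplicativeReductionAtPrime ℓ₁ ∧ ((⟨0, 1, 1, -4, 2⟩ : WeierstrassCurve ℤ).map (Int.castRingHom ℚ)).HasMultiplicativeReductionAtPrime ℓ₂ :=
    fun hns ↦ absurd (((⟨0, 1, 1, -4, 2⟩ : WeierstrassCurve ℤ).map (Int.castRingHom ℚ)).isSemistable_iff_squarefree_conductorNorm.mp hsp.2) hns
  have hD3 : NumberField.discr K ≠ -3 := by rw [hD]; norm_num
  have hD4 : NumberField.discr K ≠ -4 := by rw [hD]; norm_num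
  have hpD : ¬ (((5 : ℕ) : ℤ) ∣ NumberField.discr K) := by rw [hD]; norm_num
  exact kolyvaginClass_prime_ne_zero_iff_rankTwo_shaTrivial_twistSelmer_of_lemma84 h372 h84 _ not_hasCM
    KernelCerts001.C571b1.two_le_rank 5 (by norm_num) hgo.1 hgo.2 hasSurjectiveModNGaloisRep_pow_5 hKN hsp.1 hS2 K
    hK hD3 hD4 hpD hH

end C571b1

/-! ## `643a1 = [1, 0, 0, -4, 3]` at `(p, d_K) = (5, -8)` (N = 643 prime; `Δ = -643`; `5` inert) -/

namespace C643a1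

/-- **DEPTH-TABLE ROW `643a1`, `(p, d_K) = (5, −8)`, READ EXACTLY on the ♠ cell (two-sided; no `hF`,
no twist point, no twist pinning, no 2-descent; `5` inert in `K`).** For `E = 643a1` (two independent
points by `KernelCerts001.C643a1.two_le_rank`) and ANY imaginary quadratic `K` with `d_K = −8`: «some frame,
some Kolyvagin prime `ℓ`, some datum of conductor `ℓ` with `c_1(ℓ) ≠ 0`» `↔` «`rank E(ℚ) = 2` ∧
`Ш(E/ℚ)[5] = 0` ∧ `#Sel_5(E^{(−8)}/ℚ) ≤ 5`». Side conditions all kernel theorems (`5` good ordinary,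
`ρ_{E,5^n}` onto, non-CM, ♠ (1) + semistable from `Δ = -643`, Heegner for `N_E`). CONDITIONAL on (γ)
and W. Zhang's Lemma 8.4 (1) / Thm. 9.1 by name; per curve; BSD is not proved by it.
[cite: WZhang2014, Lemma 8.4 (1) (p. 236), Thm. 9.1 (p. 240)] [cite: GrossLMS1991, Prop. 3.7 (2)]
[cite: JetchevLauterStein2009, §3.6 (arXiv:0707.0032)] [cite: CremonaAlgorithms1997, Table 1 (643a1)] -/
theorem exactRowZhang_5_neg8
    (h372 : GrossLMS1991.prop37_2_frobeniusCongruence)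
    (h84 : Literature.NumberTheory.EllipticCurves.WZhang2014_lemma84_exists_minimal_kolyvaginClass_one_selmerCard)
    (K : Type) [Field K] [NumberField K] (hK : IsImaginaryQuadratic K)
    (hD : NumberField.discr K = -8) :
    haveI := isElliptic_c643a1;
    haveI := isGloballyMinimal_c643a1;
    haveI : NeZero (((⟨1, 0, 0, -4, 3⟩ : WeierstrassCurve ℤ).map (Int.castRingHom ℚ)).conductorNorm ℤ) := neZero_conductorNorm_of_isElliptic _;
    haveI := Fact.mk (by norm_num : Nat.Prime 5);
    (∃ (Dt : ModularParametrizationData ((⟨1, 0, 0, -4, 3⟩ : WeierstrassCurve ℤ).map (Int.castRingHom ℚ)) (((⟨1, 0, 0, -4, 3⟩ : WeierstrassCurve ℤ).map (Int.castRingHom ℚ)).conductorNorm ℤ)) (β : ℤ)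
      (ι : K →+* ℂ) (ℓ : ℕ) (d : KolyvaginHeegnerData Dt β ι ℓ),
      ℓ.Prime ∧ Zhang2014.IsKolyvaginPrime (((⟨1, 0, 0, -4, 3⟩ : WeierstrassCurve ℤ).map (Int.castRingHom ℚ)).conductorNorm ℤ) ((⟨1, 0, 0, -4, 3⟩ : WeierstrassCurve ℤ).map (Int.castRingHom ℚ)) K 5 ℓ ∧
        d.kolyvaginClass (p := 5) (by norm_num) 1 ≠ 0) ↔
    (((⟨1, 0, 0, -4, 3⟩ : WeierstrassCurve ℤ).map (Int.castRingHom ℚ)).mordellWeilRank = 2 ∧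
      (((⟨1, 0, 0, -4, 3⟩ : WeierstrassCurve ℤ).map (Int.castRingHom ℚ)).sha ⊓ AddSubgroup.torsionBy ((⟨1, 0, 0, -4, 3⟩ : WeierstrassCurve ℤ).map (Int.castRingHom ℚ)).galH1 ((5 : ℕ) : ℤ) : AddSubgroup _) = ⊥ ∧
      Nat.card ((((⟨1, 0, 0, -4, 3⟩ : WeierstrassCurve ℤ).map (Int.castRingHom ℚ)).quadraticTwist (NumberField.discr K : ℚ)).selmerGroup (5 : ℕ)) ≤ 5) := by
  haveI := isElliptic_c643a1
  haveI := isGloballyMinimal_c643a1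
  haveI : NeZero (((⟨1, 0, 0, -4, 3⟩ : WeierstrassCurve ℤ).map (Int.castRingHom ℚ)).conductorNorm ℤ) := neZero_conductorNorm_of_isElliptic _
  haveI := Fact.mk (by norm_num : Nat.Prime 5)
  have hgo := goodOrdinary_5
  have hsp := spade_5
  have hH := satisfiesHeegnerHypothesis_conductorNorm_of_intModel intModel K hK.1 hD heegner_neg8
  have hKN := not_dvd_ordMinimalDiscriminant_of_intModel_table intModel (p := 5) (Δ₀ := -643)
    (by decide +kernel) (B := 11) (by decide +kernel) (by decide +kernel)
  have hS2 : ¬ Squarefree (((⟨1, 0, 0, -4, 3⟩ : WeierstrassCurve ℤ).map (Int.castRingHom ℚ)).conductorNorm ℤ) →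
      (∃ (ℓ : ℕ) (_ : Fact ℓ.Prime), ((⟨1, 0, 0, -4, 3⟩ : WeierstrassCurve ℤ).map (Int.castRingHom ℚ)).HasMultiplicativeReductionAtPrime ℓ ∧
          ¬ 5 ∣ padicValInt ℓ ((⟨1, 0, 0, -4, 3⟩ : WeierstrassCurve ℤ).map (Int.castRingHom ℚ)).minimalDiscriminantInt) ∧
        ∃ (ℓ₁ ℓ₂ : ℕ) (_ : Fact ℓ₁.Prime) (_ : Fact ℓ₂.Prime), ℓ₁ ≠ ℓ₂ ∧
          ((⟨1, 0, 0, -4, 3⟩ : WeierstrassCurve ℤ).map (Int.castRingHom ℚ)).HasMultiplicativeReductionAtPrime ℓ₁ ∧ ((⟨1, 0, 0, -4, 3⟩ : WeierstrassCurve ℤ).map (Int.castRingHom ℚ)).HasMultiplicativeReductionAtPrime ℓ₂ :=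
    fun hns ↦ absurd (((⟨1, 0, 0, -4, 3⟩ : WeierstrassCurve ℤ).map (Int.castRingHom ℚ)).isSemistable_iff_squarefree_conductorNorm.mp hsp.2) hns
  have hD3 : NumberField.discr K ≠ -3 := by rw [hD]; norm_num
  have hD4 : NumberField.discr K ≠ -4 := by rw [hD]; norm_num
  have hpD : ¬ (((5 : ℕ) : ℤ) ∣ NumberField.discr K) := by rw [hD]; norm_num
  exact kolyvaginClass_prime_ne_zero_iff_rankTwo_shaTrivial_twistSelmer_of_lemma84 h372 h84 _ not_hasCM
    KernelCerts001.C643a1.two_le_rank 5 (by norm_num) hgo.1 hgo.2 hasSurjectiveModNGaloisRep_pow_5 hKN hsp.1 hS2 K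
    hK hD3 hD4 hpD hH

end C643a1

end Summit.BirchSwinnertonDyer.BirchSwinnertonDyer.Theorems.KolyvaginDepthDoor

end
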